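import Mathlib
import HarnessLib
import Summits.AtomisticToContinuum.Crystallization.Theorems.FrustratedLawDichotomyTwoShellRigidityLsFitDataHcp01
import Summits.AtomisticToContinuum.Crystallization.Theorems.FrustratedLawDichotomyTwoShellRigidityLsFitDataHcp04
import Summits.AtomisticToContinuum.Crystallization.Theorems.FrustratedLawDichotomyTwoShellRigidityLsFitDataHcp08
import Summits.AtomisticToContinuum.Crystallization.Theorems.FrustratedLawDichotomyTwoShellRigidityLsFitDataHcp12
import Summits.AtomisticToContinuum.Crystallization.Theorems.FrustratedLawDichotomyTwoShellRigidityLsFitDataHcp15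
import Summits.AtomisticToContinuum.Crystallization.Theorems.FrustratedLawDichotomyTwoShellRigidityLsFitDataHcp16

/-!
# Two-shell rigidity, slot 3 · `SphericalLsFit` certificate data (hcp): the full cell list

`hcpCellsF` = the 100 decoded cells of the braced ω-sub-leaf B-run of record, concatenated in order from the shard cell lists
(hcpCellsF01, hcpCellsF04, hcpCellsF08, hcpCellsF12, hcpCellsF15, hcpCellsF16); parameters `prmHcp` in `…LsFitPrmHcp`.  decomp-a2c census-1 g22.
-/

namespace Summit.AtomisticToContinuum.Crystallization.Theorems

namespace Rig

/-- The decoded hcp fit cells (all shards, in order). -/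
def hcpCellsF : List CellF := hcpCellsF01 ++ hcpCellsF04 ++ hcpCellsF08 ++ hcpCellsF12 ++ hcpCellsF15 ++ hcpCellsF16

end Rig

end Summit.AtomisticToContinuum.Crystallization.Theorems
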